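import Summits.ValiantsHypothesis.ValiantsHypothesis.Theorems.SymPencilSingFiveLeafRowsGraph
import Summits.ValiantsHypothesis.ValiantsHypothesis.Theorems.SymPencilPerFourOneRowToricR1N

/-!
# Route `SymPencil` — the V-side of the size-27 cell `(11, 5, 4)`, PORT of val-idea-18's cascade, leaf R1N: dispatch, PURE, the leaf
# (`--supports` stmt-ValiantsHypothesis-5674 `SdcSuperquadratic`; verbatim port of §2j (dispatch) – §2k of
# `Cruxes/SdcSuperquadratic/Lines/sing_five_classification.lean` rev 10/11 (val-idea-18 g5); PORT-PLAN-115.md; rung currency only)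

`residual_of_branches` (kernel-plane dispatch TORIC / PRODUCT / PURE over ✓ `perpPlanes permOrthPairs`, GRAPH by `graph_false`),
`pure_false : R1NPure K` (memo §6.4), `residual_of_toric_product`, and the leaf: `R1N_residual : R1NToric K ∧ R1NProduct K` from
✓ `SymPencilPerFourOneRowToric.r1nToric` / ✓ `SymPencilPerFourOneRowProduct.r1nProduct` (rev 11 of the workfile),
`threeRowsFourCols_residual`, `threeRowsFourCols` (= the workfile's `stub_threeRowsFourCols`).

Honest framing: [folklore] a verbatim port; `27 ≤ sdc(per₄) ≤ 29` unchanged; the crux `SdcSuperquadratic` and `VP ≠ VNP` untouched; no summit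
statement is proved here.  No definitions, no named facts.
-/

noncomputable section

-- single-conjunct layout: Sub = Summit, duplicated namespace component intended
set_option linter.dupNamespace false

namespace Summit.ValiantsHypothesis.ValiantsHypothesis.Theorems.SymPencilSingFiveClassification

open MvPolynomial Module Matrix
open scoped Polynomial
open Literature.Computability.AlgebraicComplexity
open Summit.ValiantsHypothesis.ValiantsHypothesis.Theorems
open Summit.ValiantsHypothesis.ValiantsHypothesis.Theorems.SymPencilSingSixClassification
open Summit.ValiantsHypothesis.ValiantsHypothesis.Theorems.SymPencilPerFourJointFamilyTransport

open Summit.ValiantsHypothesis.ValiantsHypothesis.Theorems.SymPencilPerFourOneRowKernelPlane (T3_zero₂)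

variable {K : Type*} [Field K]

/-- **Kernel-plane dispatch** (memo §6.4): the rev-9 residual follows from the three branches
TORIC, PRODUCT, PURE — the GRAPH branch is ✗ `graph_false`, the perm-orthogonality … (memo). [folklore] -/
theorem residual_of_branches [CharZero K] (hT : R1NToric K) (hPr : R1NProduct K)
    (hPu : R1NPure K) :
    ∀ W : Submodule K (Fin 4 × Fin 4 → K), Sing3 W → finrank K W = 5 →
      (∀ x ∈ W, ∀ j : Fin 4, x (3, j) = 0) →
      ¬ (∃ j : Fin 4, ∀ x ∈ W, ∀ i : Fin 4, x (i, j) = 0) →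
      ¬ TwoZeroRows W → ¬ InCross W → PerDirFour W →
      (∀ r : Fin 4, W.map (rowL (K := K) r) ≠ ⊤) → False := by
  intro W hS h5 hrow hncol hn2 hnX hP hnt
  have hle3 : ∀ r, finrank K (W.map (rowL (K := K) r)) ≤ 3 := by
    intro r
    have hlt := Submodule.finrank_lt_finrank_of_lt (lt_top_iff_ne_top.2 (hnt r))
    rw [finrank_top, Module.finrank_fintype_fun_eq_card, Fintype.card_fin] at hlt
    omega
  by_cases h2 : ∀ r, finrank K (W.map (rowL (K := K) r)) ≤ 2
  · exact hT W hS h5 hrow hncol hn2 hnX hP h2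
  push Not at h2
  obtain ⟨r, hr⟩ := h2
  have hn3 : finrank K (W.map (rowL (K := K) r)) = 3 := by
    have := hle3 r
    omega
  have hr3 : r ≠ 3 := by
    rintro rfl
    have hbot : W.map (rowL (K := K) 3) = ⊥ := by
      rw [Submodule.eq_bot_iff]
      rintro _ ⟨x, hx, rfl⟩
      ext m
      exact hrow x hx m
    rw [hbot, finrank_bot] at hn3
    omega
  have aux : ∀ r' : Fin 4, r' ≠ 3 → ∃ s t : Fin 4, r' ≠ s ∧ r' ≠ t ∧ s ≠ t ∧ s ≠ 3 ∧ t ≠ 3 ∧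
      ∀ i : Fin 4, i = r' ∨ i = s ∨ i = t ∨ i = 3 := by decide
  obtain ⟨s, t, hrs, hrt, hst, hs3, ht3, hcov⟩ := aux r hr3
  have hDfin : finrank K (kerPlane W r) = 2 := by
    have h := finrank_kerPlane W r
    rw [hn3] at h
    have h5W : finrank K W = 5 := h5
    omega
  have hsupp : ∀ d ∈ kerPlane W r, ∀ i, i ≠ s → i ≠ t → row d i = 0 := by
    intro d hd i his hit
    obtain ⟨hdW, hdr⟩ := (mem_kerPlane W r d).1 hd
    rcases hcov i with rfl | rfl | rfl | rfl
    · exact hdr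
    · exact absurd rfl his
    · exact absurd rfl hit
    · ext m
      exact hrow d hdW m
  have hperp : ∀ d ∈ kerPlane W r, PermOrth (row d s) (row d t) := by
    intro d hd
    obtain ⟨hdW, hdr⟩ := (mem_kerPlane W r d).1 hd
    exact ker_permOrth hS hrs hrt hst (by omega) hdW hdr
  rcases perpPlanes permOrthPairs (kerPlane W r) s t hst hsupp (by omega) hperp with
    hps | hpt | ⟨-, hprod | hgraph⟩
  · exact hPu W hS h5 hrow hncol hn2 hnX hP r s t hrs hrt hst hr3 hs3 ht3 hn3
      (fun d hdW hdr => hps d ((mem_kerPlane W r d).2 ⟨hdW, hdr⟩))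
  · exact hPu W hS h5 hrow hncol hn2 hnX hP r t s hrt hrs (Ne.symm hst) hr3 ht3 hs3 hn3
      (fun d hdW hdr => hpt d ((mem_kerPlane W r d).2 ⟨hdW, hdr⟩))
  · obtain ⟨j, c, α, β, hjc, hαβ, hiff⟩ := hprod
    refine hPr W hS h5 hrow hncol hn2 hnX hP r s t hrs hrt hst hr3 hs3 ht3 hn3
      ⟨j, c, α, β, hjc, hαβ, fun d => ?_⟩
    rw [← mem_kerPlane W r d]
    exact hiff d
  · obtain ⟨j, c, e, hjc, he, hiff⟩ := hgraph
    exact graph_false W h5 hrow hncol hP r s t hrs hrt hr3 hs3 ht3 hcov hn3 j c e he hiff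

/-! ## 2k. Leaf R1N — the PURE kernel plane is impossible (memo §6.4) -/

/-- Additivity of `T3` in the middle slot. [folklore] -/
theorem T3_add₂ (u v v' w : Fin 4 → K) (l : Fin 4) :
    T3 u (v + v') w l = T3 u v w l + T3 u v' w l := by
  simp only [T3, Pi.add_apply]; ring

/-- `T3 u v b l = v_m · (P(u,b))_{l m}` when `u_m = b_m = 0` and `l ≠ m`. [folklore] -/
theorem T3_factor (u v b : Fin 4 → K) (m l : Fin 4) (hum : u m = 0) (hbm : b m = 0)
    (hl : l ≠ m) : T3 u v b l = v m * T3 (Pi.single m 1) u b l := by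
  have hi4 : ∀ i : Fin 4, i = 0 ∨ i = 1 ∨ i = 2 ∨ i = 3 := by decide
  rcases hi4 m with rfl | rfl | rfl | rfl <;> rcases hi4 l with rfl | rfl | rfl | rfl <;>
    first
    | exact absurd rfl hl
    | (simp [T3, Fin.succAbove, hum, hbm]; ring)

/-- The table entry `ck m c` is not `m`. -/
theorem ck_ne_self : ∀ m c : Fin 4, m ≠ c → ck m c ≠ m := by decide
/-- The table entry `cl m c` is not `m`. -/
theorem cl_ne_self : ∀ m c : Fin 4, m ≠ c → cl m c ≠ m := by decide

/-- `T3 e_m e_κ b l = b_c` for `{m, κ, l, c}` a permutation (`κ = ck m c`, `l = cl m c`). -/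
theorem T3_single_single (b : Fin 4 → K) : ∀ m c : Fin 4, m ≠ c →
    T3 (Pi.single m 1) (Pi.single (ck m c) 1) b (cl m c) = b c := by
  intro m c hmc
  fin_cases m <;> fin_cases c <;> first
    | exact absurd rfl hmc
    | simp [ck, cl, T3, Fin.succAbove]

/-- **PURE kernel plane is impossible** (memo §6.4): if the live row `r` has rank `3` and its
kernel plane `K_r` is pure-`t` (row `s ≡ 0` on it), then (T1′) on `(r,t)` gives a … (memo). [folklore] -/
theorem pure_false [CharZero K] : R1NPure K := by
  intro W hS h5 hrow hncol _hn2 _hnX hP r s t hrs hrt hst hr3 hs3 ht3 hn3 hpure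
  have aux : ∀ r s t : Fin 4, r ≠ s → r ≠ t → s ≠ t → r ≠ 3 → s ≠ 3 → t ≠ 3 →
      ∀ i : Fin 4, i = r ∨ i = s ∨ i = t ∨ i = 3 := by decide
  have hcov := aux r s t hrs hrt hst hr3 hs3 ht3
  have zero_of : ∀ x ∈ W, (∀ m, x (r, m) = 0) → (∀ m, x (s, m) = 0) → (∀ m, x (t, m) = 0) →
      x = 0 := by
    intro x hx h1 h2 h3
    ext ⟨i, m⟩
    rw [Pi.zero_apply]
    rcases hcov i with rfl | rfl | rfl | rfl
    · exact h1 m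
    · exact h2 m
    · exact h3 m
    · exact hrow x hx m
  have nps : ∀ x ∈ W, (∀ m, x (r, m) = 0) → (∀ m, x (t, m) = 0) → x = 0 := by
    intro x hx h1 h3
    have h2 := hpure x hx (funext fun m => h1 m)
    exact zero_of x hx h1 (fun m => congr_fun h2 m) h3
  obtain ⟨m, hm⟩ := common_col_gen W h5 hrow hP r t hrt hr3 ht3 nps
  obtain ⟨y₀, hy₀, hy₀m⟩ : ∃ y₀ ∈ W, y₀ (s, m) ≠ 0 := by
    by_contra hcon
    push Not at hcon
    refine hncol ⟨m, fun x hx i => ?_⟩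
    rcases hcov i with rfl | rfl | rfl | rfl
    · exact (hm x hx).1
    · exact hcon x hx
    · exact (hm x hx).2
    · exact hrow x hx m
  have step : ∀ y ∈ W, ∀ k ∈ W, row k r = 0 → ∀ l, l ≠ m →
      y (s, m) * T3 (Pi.single m 1) (row y r) (row k t) l = 0 := by
    intro y hy k hk hkr l hl
    have hp := polar₁ hS hrs hrt hst hy hk hkr l
    rw [hpure k hk hkr, T3_zero₂, add_zero,
      T3_factor (row y r) (row y s) (row k t) m l (hm y hy).1 (hm k hk).2 hl] at hp
    exact hp
  have all : ∀ y ∈ W, ∀ k ∈ W, row k r = 0 → ∀ l, l ≠ m →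
      T3 (Pi.single m 1) (row y r) (row k t) l = 0 := by
    intro y hy k hk hkr l hl
    by_cases hym : y (s, m) = 0
    · have h0 : T3 (Pi.single m 1) (row y₀ r) (row k t) l = 0 :=
        (mul_eq_zero.1 (step y₀ hy₀ k hk hkr l hl)).resolve_left hy₀m
      have h01 := step (y₀ + y) (W.add_mem hy₀ hy) k hk hkr l hl
      have hne : (y₀ + y) (s, m) ≠ 0 := by
        rw [Pi.add_apply, hym, add_zero]
        exact hy₀m
      have h01' := (mul_eq_zero.1 h01).resolve_left hne
      rw [row_add, T3_add₂, h0, zero_add] at h01'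
      exact h01'
    · exact (mul_eq_zero.1 (step y hy k hk hkr l hl)).resolve_left hym
  have hAm : ∀ u ∈ W.map (rowL (K := K) r), u m = 0 := by
    rintro _ ⟨y, hy, rfl⟩
    exact (hm y hy).1
  have hsup : W.map (rowL (K := K) r) ⊔ K ∙ (Pi.single m (1 : K) : Fin 4 → K) = ⊤ := by
    apply Submodule.eq_top_of_finrank_eq
    have h1 := finrank_sup_single (W.map (rowL (K := K) r)) m hAm
    have h2 : finrank K (Fin 4 → K) = 4 := by
      rw [Module.finrank_fintype_fun_eq_card, Fintype.card_fin]
    omega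
  have unit_mem : ∀ κ : Fin 4, κ ≠ m → ∃ y ∈ W, row y r = Pi.single κ 1 := by
    intro κ hκ
    have hmem : (Pi.single κ (1 : K) : Fin 4 → K) ∈
        W.map (rowL (K := K) r) ⊔ K ∙ (Pi.single m (1 : K) : Fin 4 → K) := by
      rw [hsup]
      exact Submodule.mem_top
    obtain ⟨a, ha, z, hz, haz⟩ := Submodule.mem_sup.1 hmem
    obtain ⟨c, rfl⟩ := Submodule.mem_span_singleton.1 hz
    have hc : c = 0 := by
      have := congr_fun haz m
      simpa [hAm a ha, Pi.single_apply, Ne.symm hκ] using this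
    rw [hc, zero_smul, add_zero] at haz
    obtain ⟨y, hy, rfl⟩ := ha
    exact ⟨y, hy, haz⟩
  have kzero : ∀ k ∈ W, row k r = 0 → k = 0 := by
    intro k hk hkr
    have hks := hpure k hk hkr
    refine zero_of k hk (fun m' => congr_fun hkr m') (fun m' => congr_fun hks m') ?_
    intro c
    by_cases hcm : c = m
    · rw [hcm]
      exact (hm k hk).2
    · obtain ⟨y, hy, hyr⟩ := unit_mem (ck m c) (ck_ne_self m c (Ne.symm hcm))
      have h := all y hy k hk hkr (cl m c) (cl_ne_self m c (Ne.symm hcm))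
      rw [hyr, T3_single_single (row k t) m c (Ne.symm hcm)] at h
      exact h
  have hD : kerPlane W r = ⊥ := by
    rw [Submodule.eq_bot_iff]
    intro k hk
    obtain ⟨hkW, hkr⟩ := (mem_kerPlane W r k).1 hk
    exact kzero k hkW hkr
  have h := finrank_kerPlane W r
  rw [hD, finrank_bot, hn3] at h
  have h5W : finrank K W = 5 := h5
  omega

/-- **Kernel-plane dispatch, PURE discharged**: the rev-9 residual follows from TORIC and PRODUCT. -/
theorem residual_of_toric_product [CharZero K] (hT : R1NToric K) (hPr : R1NProduct K) :
    ∀ W : Submodule K (Fin 4 × Fin 4 → K), Sing3 W → finrank K W = 5 →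
      (∀ x ∈ W, ∀ j : Fin 4, x (3, j) = 0) →
      ¬ (∃ j : Fin 4, ∀ x ∈ W, ∀ i : Fin 4, x (i, j) = 0) →
      ¬ TwoZeroRows W → ¬ InCross W → PerDirFour W →
      (∀ r : Fin 4, W.map (rowL (K := K) r) ≠ ⊤) → False :=
  residual_of_branches hT hPr pure_false

/-- **Leaf R1N — the narrowed residual** `R1NToric K ∧ R1NProduct K`, PROVED by ✓ `SymPencilPerFourOneRowToric.r1nToric` and
✓ `SymPencilPerFourOneRowProduct.r1nProduct` (their statements are the two conjuncts with `PerDirFour` unfolded). [folklore] -/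
theorem R1N_residual [CharZero K] : R1NToric K ∧ R1NProduct K :=
  ⟨fun W hS h5 hrow hncol hn2 hnX hP hle =>
    SymPencilPerFourOneRowToric.r1nToric W hS h5 hrow hncol hn2 hnX hP hle,
   fun W hS h5 hrow hncol hn2 hnX hP =>
    SymPencilPerFourOneRowProduct.r1nProduct W hS h5 hrow hncol hn2 hnX hP⟩

/-- The rev-9 residual «normal form, every live row of rank ≤ 3 ⇒ False» (the workfile's `stub_threeRowsFourCols_residual`),
from `R1N_residual` by the kernel-plane dispatch `residual_of_toric_product`. [folklore] -/
theorem threeRowsFourCols_residual [CharZero K] :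
    ∀ W : Submodule K (Fin 4 × Fin 4 → K), Sing3 W → finrank K W = 5 →
      (∀ x ∈ W, ∀ j : Fin 4, x (3, j) = 0) →
      ¬ (∃ j : Fin 4, ∀ x ∈ W, ∀ i : Fin 4, x (i, j) = 0) →
      ¬ TwoZeroRows W → ¬ InCross W → PerDirFour W →
      (∀ r : Fin 4, W.map (rowL (K := K) r) ≠ ⊤) → False :=
  residual_of_toric_product R1N_residual.1 R1N_residual.2

/-- **Leaf R1N** (the workfile's `stub_threeRowsFourCols`): exactly one zero row, no zero column, not in a cross — impossible under
a per-direction family of `≤ 4` squares at every element; from `threeRowsFourCols_residual` by `threeRowsFourCols_of_residual`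
(normalisation to zero row `3`, the full-row-rank branch (B3)). [folklore] -/
theorem threeRowsFourCols [CharZero K] :
    ∀ W : Submodule K (Fin 4 × Fin 4 → K), Sing3 W → finrank K W = 5 →
      (∃ i : Fin 4, ∀ x ∈ W, ∀ j : Fin 4, x (i, j) = 0) →
      ¬ (∃ j : Fin 4, ∀ x ∈ W, ∀ i : Fin 4, x (i, j) = 0) →
      ¬ TwoZeroRows W → ¬ InCross W → PerDirFour W → False :=
  threeRowsFourCols_of_residual threeRowsFourCols_residual

end Summit.ValiantsHypothesis.ValiantsHypothesis.Theorems.SymPencilSingFiveClassification
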